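import Summits.Ventures.HodgeRepro2.T5CartanU11

/-!
# T5CartanSU11 — SU(1,1) = {[[a, b], [b̄, ā]]} and its Cartan coordinates SO(2) · A⁺ · SO(2)

Support file for sub-step N4.3 = (R3) of the Tier-5 discharge of (N) (route/T5-N4-p5.md,
owner p5), written by seat p1 of the blind cell pub-hodge-repro2.

README §8(d) declaration: uses an L-value-free non-vanishing device: **no** — matrix algebra in
support of (N4.3.P2′), a line on the record since N4.3 v1 (2026-08-25T01:25:26Z, STATUS l. 818).

## What is proved

(N4.3.P2′) writes an element of H_j = U(1,1) as g = z · u(ψ₁) d(η) u(ψ₂) ∈ Z_j · H_j¹ with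
H_j¹ = SU(1,1) in Rühl's coordinates.  This file supplies the SU(1,1) half in kernel form, for
U(1,1) = {g : gᴴ J g = J} of `T5UnitaryBound` and the Cartan decomposition of `T5CartanU11`:

* `det_hyperbolicC`, `det_cartan` — det a_t = 1 and det(diag(u, w) a_t diag(1, v)) = u w v;
* `entry_11_eq_conj_00`, `entry_10_eq_conj_01` — an element of U(1,1) of determinant 1 has the
  shape [[a, b], [b̄, ā]] (so SU(1,1) = {[[a, b], [b̄, ā]] : |a|² − |b|² = 1} with
  `T5CartanU11.norm_sq_entry_00`);
* `exists_cartan_det_one` — **SU(1,1) = SO(2) · A⁺ · SO(2)**: every h ∈ U(1,1) with det h = 1 is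
  h = diag(α, ᾱ) · a_t · diag(β, β̄) with |α| = |β| = 1 and t ≥ 0 — Rühl's (ψ₁, η, ψ₂) with
  α = e^{iψ₁/2}, β = e^{iψ₂/2}, t = η/2 (the parameter t = arsinh |h₁₀| by
  `T5CartanU11.cartan_param_unique`).

## What is NOT formalised (honest scope)

The identification SU(1,1) ≅ SL(2, ℝ), Rühl's Haar measure ½ sinh η dη dψ₁ dψ₂ / (4π)², the
matrix coefficients, anything representation-theoretic.  Mathlib only (plus the cell's own
`T5UnitaryBound` / `T5CartanU11`); no new definitions.
-/

namespace Summit.Ventures.HodgeRepro2.T5CartanSU11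

open Complex
open Summit.Ventures.HodgeRepro2.T5UnitaryBound
open Summit.Ventures.HodgeRepro2.T5CartanU11

/-- det a_t = cosh² t − sinh² t = 1. -/
theorem det_hyperbolicC (t : ℝ) : (hyperbolicC t).det = 1 := by
  simp only [hyperbolicC, Matrix.det_fin_two_of]
  norm_cast
  linear_combination Real.cosh_sq_sub_sinh_sq t

/-- det(diag(u, w) · a_t · diag(1, v)) = u w v. -/
theorem det_cartan (u w v : ℂ) (t : ℝ) :
    (!![u, 0; 0, w] * hyperbolicC t * !![1, 0; 0, v]).det = u * w * v := by
  rw [Matrix.det_mul, Matrix.det_mul, det_hyperbolicC, Matrix.det_fin_two_of,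
    Matrix.det_fin_two_of]
  ring

/-- The product diag(α, α′) · a_t · diag(β, β′), entry by entry. -/
theorem cartan_entries_general (α α' β β' : ℂ) (t : ℝ) :
    !![α, 0; 0, α'] * hyperbolicC t * !![β, 0; 0, β'] =
      !![α * (Real.cosh t : ℂ) * β, α * (Real.sinh t : ℂ) * β';
         α' * (Real.sinh t : ℂ) * β, α' * (Real.cosh t : ℂ) * β'] := by
  simp [hyperbolicC]

/-- On U(1,1) ∩ {det = 1} the (1,1) entry is the conjugate of the (0,0) entry. -/
theorem entry_11_eq_conj_00 {h : Matrix (Fin 2) (Fin 2) ℂ} (hh : MemU11 h) (hd : h.det = 1) :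
    h 1 1 = (starRingEnd ℂ) (h 0 0) := by
  have r1 : (starRingEnd ℂ) (h 0 0) * h 0 0 - (starRingEnd ℂ) (h 1 0) * h 1 0 = 1 := by
    simpa [J] using col_rel hh 0 0
  have r2 : (starRingEnd ℂ) (h 0 0) * h 0 1 - (starRingEnd ℂ) (h 1 0) * h 1 1 = 0 := by
    simpa [J] using col_rel hh 0 1
  have hd' : h 0 0 * h 1 1 - h 0 1 * h 1 0 = 1 := by
    rw [Matrix.det_fin_two] at hd; exact hd
  linear_combination (starRingEnd ℂ) (h 0 0) * hd' + h 1 0 * r2 - h 1 1 * r1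

/-- On U(1,1) ∩ {det = 1} the (1,0) entry is the conjugate of the (0,1) entry. -/
theorem entry_10_eq_conj_01 {h : Matrix (Fin 2) (Fin 2) ℂ} (hh : MemU11 h) (hd : h.det = 1) :
    h 1 0 = (starRingEnd ℂ) (h 0 1) := by
  have r1 : h 0 0 * (starRingEnd ℂ) (h 0 0) - h 0 1 * (starRingEnd ℂ) (h 0 1) = 1 := by
    simpa [J] using row_rel hh 0 0
  have r2 : h 0 0 * (starRingEnd ℂ) (h 1 0) - h 0 1 * (starRingEnd ℂ) (h 1 1) = 0 := by
    simpa [J] using row_rel hh 0 1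
  have r2' : (starRingEnd ℂ) (h 0 0) * h 1 0 - (starRingEnd ℂ) (h 0 1) * h 1 1 = 0 := by
    have := congrArg (starRingEnd ℂ) r2
    simpa [map_sub, map_mul, Complex.conj_conj] using this
  have hd' : h 0 0 * h 1 1 - h 0 1 * h 1 0 = 1 := by
    rw [Matrix.det_fin_two] at hd; exact hd
  linear_combination (starRingEnd ℂ) (h 0 1) * hd' + h 0 0 * r2' - h 1 0 * r1

/-- A unit complex number has a unit square root. -/
theorem exists_unit_sq_eq {v : ℂ} (hv : ‖v‖ = 1) : ∃ s : ℂ, ‖s‖ = 1 ∧ s ^ 2 = v := by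
  refine ⟨Complex.exp (((v.arg / 2 : ℝ) : ℂ) * I), Complex.norm_exp_ofReal_mul_I _, ?_⟩
  rw [← Complex.exp_nat_mul]
  have h : ((2 : ℕ) : ℂ) * (((v.arg / 2 : ℝ) : ℂ) * I) = ((v.arg : ℝ) : ℂ) * I := by
    push_cast; ring
  rw [h]
  have h2 := Complex.norm_mul_exp_arg_mul_I v
  rw [hv, Complex.ofReal_one, one_mul] at h2
  exact h2

/-- **SU(1,1) = SO(2) · A⁺ · SO(2)**: every h ∈ U(1,1) with det h = 1 is
h = diag(α, ᾱ) · a_t · diag(β, β̄) with |α| = |β| = 1 and t ≥ 0 (Rühl's coordinates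
(ψ₁, η, ψ₂): α = e^{iψ₁/2}, β = e^{iψ₂/2}, t = η/2). -/
theorem exists_cartan_det_one {h : Matrix (Fin 2) (Fin 2) ℂ} (hh : MemU11 h) (hd : h.det = 1) :
    ∃ (α β : ℂ) (t : ℝ), ‖α‖ = 1 ∧ ‖β‖ = 1 ∧ 0 ≤ t ∧
      h = !![α, 0; 0, (starRingEnd ℂ) α] * hyperbolicC t * !![β, 0; 0, (starRingEnd ℂ) β] := by
  obtain ⟨u, w, v, t, hu, hw, hv, ht, rfl⟩ := exists_cartan hh
  have huwv : u * w * v = 1 := by rw [← det_cartan]; exact hd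
  obtain ⟨s, hs, hs2⟩ := exists_unit_sq_eq hv
  have hu1 : u * (starRingEnd ℂ) u = 1 := by rw [Complex.mul_conj', hu]; simp
  have hv1 : v * (starRingEnd ℂ) v = 1 := by rw [Complex.mul_conj', hv]; simp
  have hs1 : s * (starRingEnd ℂ) s = 1 := by rw [Complex.mul_conj', hs]; simp
  have hs2' : (starRingEnd ℂ) s ^ 2 = (starRingEnd ℂ) v := by rw [← map_pow, hs2]
  have hw' : w = (starRingEnd ℂ) u * (starRingEnd ℂ) v := by
    linear_combination ((starRingEnd ℂ) u * (starRingEnd ℂ) v) * huwv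
      - (w * v * (starRingEnd ℂ) v) * hu1 - w * hv1
  have e00 : u = u * s * (starRingEnd ℂ) s := by linear_combination (-u) * hs1
  have e01 : u * v = u * s * s := by linear_combination (-u) * hs2
  have e10 : w = (starRingEnd ℂ) u * (starRingEnd ℂ) s * (starRingEnd ℂ) s := by
    linear_combination hw' - (starRingEnd ℂ) u * hs2'
  have e11 : w * v = (starRingEnd ℂ) u * (starRingEnd ℂ) s * s := by
    linear_combination v * hw' + (starRingEnd ℂ) u * hv1 - (starRingEnd ℂ) u * hs1
  refine ⟨u * s, (starRingEnd ℂ) s, t, by rw [norm_mul, hu, hs, one_mul],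
    by rw [Complex.norm_conj, hs], ht, ?_⟩
  rw [cartan_entries, cartan_entries_general, Complex.conj_conj, map_mul]
  ext i j
  fin_cases i <;> fin_cases j
  · show u * (Real.cosh t : ℂ) = u * s * (Real.cosh t : ℂ) * (starRingEnd ℂ) s
    linear_combination (Real.cosh t : ℂ) * e00
  · show u * (Real.sinh t : ℂ) * v = u * s * (Real.sinh t : ℂ) * s
    linear_combination (Real.sinh t : ℂ) * e01
  · show w * (Real.sinh t : ℂ) =
      (starRingEnd ℂ) u * (starRingEnd ℂ) s * (Real.sinh t : ℂ) * (starRingEnd ℂ) s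
    linear_combination (Real.sinh t : ℂ) * e10
  · show w * (Real.cosh t : ℂ) * v =
      (starRingEnd ℂ) u * (starRingEnd ℂ) s * (Real.cosh t : ℂ) * s
    linear_combination (Real.cosh t : ℂ) * e11

/-- The Cartan parameter of h ∈ SU(1,1) in `exists_cartan_det_one` is t = arsinh |h₁₀|. -/
theorem cartan_param_det_one {h : Matrix (Fin 2) (Fin 2) ℂ} {α β : ℂ} {t : ℝ}
    (hα : ‖α‖ = 1) (hβ : ‖β‖ = 1) (ht : 0 ≤ t)
    (hh : h = !![α, 0; 0, (starRingEnd ℂ) α] * hyperbolicC t * !![β, 0; 0, (starRingEnd ℂ) β]) :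
    t = Real.arsinh ‖h 1 0‖ := by
  have h10 : h 1 0 = (starRingEnd ℂ) α * (Real.sinh t : ℂ) * β := by
    rw [hh, cartan_entries_general]; simp
  rw [h10, norm_mul, norm_mul, Complex.norm_conj, hα, one_mul, Complex.norm_real,
    Real.norm_of_nonneg (Real.sinh_nonneg_iff.2 ht), hβ, mul_one, Real.arsinh_sinh]

end Summit.Ventures.HodgeRepro2.T5CartanSU11
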